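import Mathlib
import Summits.NavierStokesRegularity.NavierStokesRegularity.Theorems.EulerZoomLiouvillePowerGaugeEulerLiouvilleNeedleRiseLemma
import Literature.Analysis.FluidPDE.SelfSimilarEulerProfile
import HarnessLib.Audit

/-!
# Needle portrait: the PER-LABEL FEEDING LAW (ROUND-37 (F), first half) — one backward
# similarity orbit crossing the shell `R ≤ ‖y‖ ≤ 2R` spends `√(time in the tube) · √(energy seen
# in the tube) ≥ |good radii²| / (4R)` (helper of the crux `EulerZoomLiouville.PowerGaugeEulerLiouville`,
# route №10, item stmt-NavierStokesRegularity-19832)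

Helper file (theorems only; `--supports stmt-NavierStokesRegularity-19832`). Text custody nsreg-p2
(cell ns-regularity-ideate, `HOME/ns-regularity-ideate-p2/ROUND-37.md` §2 (3)). Second file of the
feeding side (F) of the feeding-time race, after the rise lemma (`…NeedleRiseLemma`, t38b).

SETTING. `V : ℝ³ → ℝ³` continuous (the profile, or the LEAD lineage's cut-off copy of it), `γ ≥ 0`,
`W = γ y + V` (`selfSimilarTransport γ 0 V`), and ONE backward orbit `Y' = −W(Y)`. The squared
radius `r(s) = ‖Y s‖²` is `C¹` on all of `ℝ` (no polar singularity) with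
`r' = −2(⟪V(Y), Y⟫ + γ‖Y‖²)` (`hasDerivAt_norm_sq_orbit`), so `r` RISES exactly where the point is
STRICTLY γ-FAST, `⟪V(y), y⟫ < −γ‖y‖²` — the Fermat/first-exit observation (F2) of the LEAD's
`…SelfSimilarBernoulliPiercing`, here for every time, not only exit times.

* `volume_toReal_le_feeding` — if `‖Y s₁‖ ≤ R`, `‖Y s₂‖ ≥ 2R` (`s₁ ≤ s₂`, `R > 0`), `G ⊆ [R², 4R²]`
  is a measurable set of "good squared radii", `N` a measurable "tube", and LEMMA K holds in the
  form `‖z‖² ∈ G → ⟪V z, z⟫ + γ‖z‖² < 0 → z ∈ N` (a strictly fast point on a good sphere lies in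
  the tube), then
  `|G| ≤ 4R · √(∫_{[s₁,s₂]} 1_N(Y s) ds) · √(∫_{[s₁,s₂]} 1_N(Y s)‖V(Y s)‖² ds)`
  (rise lemma `NeedleRise.volume_toReal_le_integral_deriv_rise` for `r`; on the rise set the point
  is in `N` and `r' ≤ 2‖V(Y)‖‖Y‖ ≤ 4R‖V(Y)‖`; Cauchy–Schwarz in time);
* `volume_toReal_le_feeding_of_exit` — the FIRST-EXIT form on a window `[0, S]`: if `‖Y 0‖ ≤ R` and
  the orbit reaches `‖·‖ ≥ 2R` at some time in `[0, S]`, the same bound holds with both time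
  integrals restricted to the times `s ∈ [0, S]` at which the orbit HAS STAYED in `‖·‖ ≤ 2R` on
  `[0, s]` (`stayWindow`) — the form under which the label integration (second half of (F)) can
  use the LEAD's exact Jacobian `BernoulliLandscape.volume_image_flow_eq_exp_of_stay` with no
  hitting-time measurability.

With `G = {ϱ² : ϱ ∈ [R,2R] good}` and `|good| ≥ R/2` one has `|G| ≥ R²`, i.e.
`R/4 ≤ √(τ_N)·√(I_N)` — ROUND-37 §2 (3) up to the absolute constant.  NOT here: the label
integration `∫_X τ_N ≤ e^{3γS}|N|/(3γ)` (Tonelli + Jacobian) and Lemma K itself.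

References: Constantin–Ignatova–Vicol arXiv:2602.17570 §3.4 (3.19)–(3.21), §3.5 (first exits are
fast) [ConstantinIgnatovaVicol2026Putative]; (area formula / Cauchy–Schwarz) [folklore].
-/

noncomputable section

-- the summit and its single problem share the name `NavierStokesRegularity` (D-0017 nested layout)
set_option linter.dupNamespace false

open Set Filter Topology Metric Function MeasureTheory InnerProductSpace
open scoped RealInnerProductSpace NNReal ENNReal

namespace Summit.NavierStokesRegularity.NavierStokesRegularity.Theorems.PowerGaugeEulerLiouville.NeedleFeeding

open Literature.Analysis Literature.Analysis.FluidPDE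
open Summit.NavierStokesRegularity.NavierStokesRegularity.Theorems.PowerGaugeEulerLiouville.NeedleRise

variable {γ R : ℝ} {V : (EuclideanSpace ℝ (Fin 3)) → (EuclideanSpace ℝ (Fin 3))}
  {Y : ℝ → (EuclideanSpace ℝ (Fin 3))} {N : Set (EuclideanSpace ℝ (Fin 3))} {G : Set ℝ}

/-! ### The squared radius along a backward orbit -/

/-- **`d/ds ‖Y s‖² = −2(⟪V(Y s), Y s⟫ + γ‖Y s‖²)` along `Y' = −W(Y)`, `W = γy + V`.** The squared
radius rises exactly where the point is strictly γ-fast.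
[cite: ConstantinIgnatovaVicol2026Putative, §3.4 eq. (3.19)-(3.21)] -/
theorem hasDerivAt_norm_sq_orbit {s : ℝ}
    (hY : HasDerivAt Y (-(selfSimilarTransport γ 0 V (Y s))) s) :
    HasDerivAt (fun s => ‖Y s‖ ^ 2) (-(2 * (⟪V (Y s), Y s⟫ + γ * ‖Y s‖ ^ 2))) s := by
  refine hY.norm_sq.congr_deriv ?_
  rw [selfSimilarTransport_apply, sub_zero, inner_neg_right, inner_add_right, inner_smul_right,
    real_inner_self_eq_norm_sq, real_inner_comm]
  ring

/-- The rise rate is bounded by the speed seen: `−2(⟪V y, y⟫ + γ‖y‖²) ≤ 2‖V y‖‖y‖` for `γ ≥ 0`.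
[cite: ConstantinIgnatovaVicol2026Putative, §3.4 eq. (3.21)] -/
theorem riseRate_le (hγ : 0 ≤ γ) (y : EuclideanSpace ℝ (Fin 3)) :
    -(2 * (⟪V y, y⟫ + γ * ‖y‖ ^ 2)) ≤ 2 * ‖V y‖ * ‖y‖ := by
  have h1 : |⟪V y, y⟫| ≤ ‖V y‖ * ‖y‖ := abs_real_inner_le_norm _ _
  have h2 : -⟪V y, y⟫ ≤ ‖V y‖ * ‖y‖ := (neg_le_abs _).trans h1
  have h3 : 0 ≤ γ * ‖y‖ ^ 2 := by positivity
  linarith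

/-! ### The per-label feeding law between two times -/

/-- **Per-label feeding law.** Along a backward orbit `Y' = −W(Y)` (`W = γy + V`, `V` continuous,
`γ ≥ 0`) with `‖Y s₁‖ ≤ R` and `‖Y s₂‖ ≥ 2R` (`s₁ ≤ s₂`, `R > 0`): for every measurable
`G ⊆ [R², 4R²]` ("good squared radii") and measurable `N` ("tube") such that every strictly γ-fast
point on a good sphere lies in `N`,
`|G| ≤ 4R · √(∫_{[s₁,s₂]} 1_N(Y s) ds) · √(∫_{[s₁,s₂]} 1_N(Y s)‖V(Y s)‖² ds)`.
[cite: ConstantinIgnatovaVicol2026Putative, §3.5 (first exits are fast)] -/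
theorem volume_toReal_le_feeding (hV : Continuous V) (hγ : 0 ≤ γ) (hR : 0 < R)
    (hY : ∀ s, HasDerivAt Y (-(selfSimilarTransport γ 0 V (Y s))) s)
    {s₁ s₂ : ℝ} (hs : s₁ ≤ s₂) (h₁ : ‖Y s₁‖ ≤ R) (h₂ : 2 * R ≤ ‖Y s₂‖)
    (hNm : MeasurableSet N) (hGm : MeasurableSet G) (hG : G ⊆ Icc (R ^ 2) ((2 * R) ^ 2))
    (hK : ∀ z, ‖z‖ ^ 2 ∈ G → ⟪V z, z⟫ + γ * ‖z‖ ^ 2 < 0 → z ∈ N) :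
    (volume G).toReal ≤
      4 * R * Real.sqrt (∫ s in Icc s₁ s₂, (Y ⁻¹' N).indicator (fun _ => (1 : ℝ)) s) *
        Real.sqrt (∫ s in Icc s₁ s₂, (Y ⁻¹' N).indicator (fun s => ‖V (Y s)‖ ^ 2) s) := by
  have hYc : Continuous Y := continuous_iff_continuousAt.2 fun s => (hY s).continuousAt
  -- the squared radius and its derivative
  set r : ℝ → ℝ := fun s => ‖Y s‖ ^ 2 with hr
  set r' : ℝ → ℝ := fun s => -(2 * (⟪V (Y s), Y s⟫ + γ * ‖Y s‖ ^ 2)) with hr'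
  have hrd : ∀ s, HasDerivAt r (r' s) s := fun s => hasDerivAt_norm_sq_orbit (hY s)
  have hr'c : Continuous r' := by
    have h1 : Continuous fun s => ⟪V (Y s), Y s⟫ := (hV.comp hYc).inner hYc
    have h2 : Continuous fun s => ‖Y s‖ ^ 2 := (hYc.norm).pow 2
    simp only [hr']
    fun_prop
  -- the rise lemma
  have hGsub : G ⊆ Icc (r s₁) (r s₂) := by
    intro x hx
    have hx' := hG hx
    refine ⟨le_trans ?_ hx'.1, hx'.2.trans ?_⟩
    · simp only [hr]
      exact pow_le_pow_left₀ (norm_nonneg _) h₁ 2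
    · simp only [hr]
      exact pow_le_pow_left₀ (by linarith) h₂ 2
  have hrise := volume_toReal_le_integral_deriv_rise hrd hr'c hs hGm hGsub
  set Ep : Set ℝ := Icc s₁ s₂ ∩ r ⁻¹' G ∩ {s | 0 < r' s} with hEp
  have hEpm : MeasurableSet Ep :=
    (measurableSet_Icc.inter (hGm.preimage (hYc.norm.pow 2).measurable)).inter
      (measurableSet_lt measurable_const hr'c.measurable)
  have hEpsub : Ep ⊆ Icc s₁ s₂ := inter_subset_left.trans inter_subset_left
  -- the two time-densities
  set f : ℝ → ℝ := fun s => (Y ⁻¹' N).indicator (fun _ => (1 : ℝ)) s with hf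
  set g : ℝ → ℝ := fun s => (Y ⁻¹' N).indicator (fun s => ‖V (Y s)‖) s with hg
  have hYNm : MeasurableSet (Y ⁻¹' N) := hNm.preimage hYc.measurable
  have hfm : Measurable f := measurable_const.indicator hYNm
  have hgm : Measurable g := (hV.comp hYc).norm.measurable.indicator hYNm
  have hf_nn : ∀ s, 0 ≤ f s := fun s => by
    simp only [hf]; exact Set.indicator_nonneg (fun _ _ => zero_le_one) _
  have hg_nn : ∀ s, 0 ≤ g s := fun s => by
    simp only [hg]; exact Set.indicator_nonneg (fun _ _ => norm_nonneg _) _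
  have hf_le : ∀ s, f s ≤ 1 := fun s => by
    simp only [hf]; exact Set.indicator_le_self' (fun _ _ => zero_le_one) _
  -- a bound for `‖V (Y s)‖` on the compact time interval
  obtain ⟨M, hM⟩ : ∃ M, ∀ s ∈ Icc s₁ s₂, ‖V (Y s)‖ ≤ M := by
    obtain ⟨M, hM⟩ := isCompact_Icc.exists_bound_of_continuousOn
      ((hV.comp hYc).continuousOn (s := Icc s₁ s₂))
    exact ⟨M, fun s hs => hM s hs⟩
  have hM0 : 0 ≤ M := (norm_nonneg _).trans (hM s₁ (left_mem_Icc.2 hs))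
  have hg_le : ∀ s ∈ Icc s₁ s₂, g s ≤ M := fun s hs => by
    simp only [hg]
    exact Set.indicator_apply_le' (fun _ => hM s hs) (fun _ => hM0)
  -- (1) on the rise set the point is in the tube and `r' ≤ 4R g`
  have hEp_tube : ∀ s ∈ Ep, Y s ∈ N := by
    intro s hs
    have hsG : r s ∈ G := hs.1.2
    have hpos : 0 < r' s := hs.2
    refine hK (Y s) hsG ?_
    simp only [hr'] at hpos
    linarith
  have hEp_norm : ∀ s ∈ Ep, ‖Y s‖ ≤ 2 * R := by
    intro s hs
    have hsG : r s ∈ G := hs.1.2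
    have h4 : ‖Y s‖ ^ 2 ≤ (2 * R) ^ 2 := (hG hsG).2
    exact (abs_le_of_sq_le_sq' h4 (by linarith)).2
  have hr'_le : ∀ s ∈ Ep, r' s ≤ 4 * R * (f s * g s) := by
    intro s hs
    have hN : Y s ∈ N := hEp_tube s hs
    have hfs : f s = 1 := by simp only [hf]; exact Set.indicator_of_mem (show s ∈ Y ⁻¹' N from hN) _
    have hgs : g s = ‖V (Y s)‖ := by
      simp only [hg]; exact Set.indicator_of_mem (show s ∈ Y ⁻¹' N from hN) _
    rw [hfs, hgs, one_mul]
    calc r' s ≤ 2 * ‖V (Y s)‖ * ‖Y s‖ := riseRate_le hγ (Y s)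
      _ ≤ 2 * ‖V (Y s)‖ * (2 * R) :=
          mul_le_mul_of_nonneg_left (hEp_norm s hs) (by positivity)
      _ = 4 * R * ‖V (Y s)‖ := by ring
  -- (2) integrate: `∫_{Ep} r' ≤ 4R ∫_{Icc} f g`
  have hfg_int : IntegrableOn (fun s => f s * g s) (Icc s₁ s₂) volume := by
    refine Measure.integrableOn_of_bounded (M := M) measure_Icc_lt_top.ne
      (hfm.mul hgm).aestronglyMeasurable ?_
    refine (ae_restrict_iff' measurableSet_Icc).2 (Filter.Eventually.of_forall fun s hs => ?_)
    rw [Real.norm_eq_abs, abs_of_nonneg (mul_nonneg (hf_nn s) (hg_nn s))]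
    calc f s * g s ≤ 1 * M := mul_le_mul (hf_le s) (hg_le s hs) (hg_nn s) zero_le_one
      _ = M := one_mul M
  have hr'int : IntegrableOn r' Ep volume :=
    (hr'c.continuousOn.integrableOn_compact isCompact_Icc).mono_set hEpsub
  have hstep1 : ∫ s in Ep, r' s ≤ ∫ s in Ep, 4 * R * (f s * g s) := by
    refine setIntegral_mono_on hr'int ((hfg_int.mono_set hEpsub).const_mul _) hEpm hr'_le
  have hstep2 : ∫ s in Ep, 4 * R * (f s * g s) ≤ ∫ s in Icc s₁ s₂, 4 * R * (f s * g s) := by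
    refine setIntegral_mono_set (hfg_int.const_mul _) ?_ (Filter.Eventually.of_forall hEpsub)
    exact Filter.Eventually.of_forall fun s => by
      have := mul_nonneg (hf_nn s) (hg_nn s); positivity
  -- (3) Cauchy–Schwarz in time
  haveI : IsFiniteMeasure (volume.restrict (Icc s₁ s₂)) := Real.isFiniteMeasure_restrict_Icc s₁ s₂
  have hfL2 : MemLp f (ENNReal.ofReal 2) (volume.restrict (Icc s₁ s₂)) :=
    MemLp.of_bound hfm.aestronglyMeasurable 1 (Filter.Eventually.of_forall fun s => by
      rw [Real.norm_eq_abs, abs_of_nonneg (hf_nn s)]; exact hf_le s)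
  have hgL2 : MemLp g (ENNReal.ofReal 2) (volume.restrict (Icc s₁ s₂)) :=
    MemLp.of_bound hgm.aestronglyMeasurable M ((ae_restrict_iff' measurableSet_Icc).2
      (Filter.Eventually.of_forall fun s hs => by
        rw [Real.norm_eq_abs, abs_of_nonneg (hg_nn s)]; exact hg_le s hs))
  have hCS := integral_mul_le_Lp_mul_Lq_of_nonneg Real.HolderConjugate.two_two
    (Filter.Eventually.of_forall hf_nn) (Filter.Eventually.of_forall hg_nn) hfL2 hgL2
  -- rewrite `f² = f`, `g² = 1_N ‖V‖²`, `x^{1/2} = √x`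
  have hf2 : ∀ s, f s ^ (2 : ℝ) = (Y ⁻¹' N).indicator (fun _ => (1 : ℝ)) s := by
    intro s
    by_cases hN : s ∈ Y ⁻¹' N
    · simp only [hf, Set.indicator_of_mem hN, Real.one_rpow]
    · simp only [hf, Set.indicator_of_notMem hN, Real.zero_rpow two_ne_zero]
  have hg2 : ∀ s, g s ^ (2 : ℝ) = (Y ⁻¹' N).indicator (fun s => ‖V (Y s)‖ ^ 2) s := by
    intro s
    by_cases hN : s ∈ Y ⁻¹' N
    · simp only [hg, Set.indicator_of_mem hN, Real.rpow_two]
    · simp only [hg, Set.indicator_of_notMem hN, Real.zero_rpow two_ne_zero]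
  simp_rw [hf2, hg2, ← Real.sqrt_eq_rpow] at hCS
  -- assemble
  calc (volume G).toReal ≤ ∫ s in Ep, r' s := hrise
    _ ≤ ∫ s in Icc s₁ s₂, 4 * R * (f s * g s) := hstep1.trans hstep2
    _ = 4 * R * ∫ s in Icc s₁ s₂, f s * g s := integral_const_mul _ _
    _ ≤ 4 * R * (Real.sqrt (∫ s in Icc s₁ s₂, (Y ⁻¹' N).indicator (fun _ => (1 : ℝ)) s) *
          Real.sqrt (∫ s in Icc s₁ s₂, (Y ⁻¹' N).indicator (fun s => ‖V (Y s)‖ ^ 2) s)) :=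
        mul_le_mul_of_nonneg_left hCS (by positivity)
    _ = _ := by ring

/-! ### The first-exit form with the STAY window -/

/-- The STAY WINDOW of an orbit at level `L`: the times `s` such that `‖Y σ‖ ≤ L` for all
`σ ∈ [0, s]`. [folklore] -/
theorem ordConnected_stayWindow (L : ℝ) :
    OrdConnected {s : ℝ | ∀ σ ∈ Icc 0 s, ‖Y σ‖ ≤ L} := by
  refine ⟨fun a _ b hb c hc σ hσ => hb σ ⟨hσ.1, hσ.2.trans hc.2⟩⟩

/-- The stay window is measurable (it is order-connected). [folklore] -/
theorem measurableSet_stayWindow (L : ℝ) :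
    MeasurableSet {s : ℝ | ∀ σ ∈ Icc 0 s, ‖Y σ‖ ≤ L} :=
  (ordConnected_stayWindow L).measurableSet

/-- **First exit.** If `‖Y 0‖ < L` and `L ≤ ‖Y s‖` for some `s ∈ [0, S]` (`Y` continuous), there is
a first such time `s₂ ∈ (0, S]` with `‖Y s₂‖ = L` and `‖Y σ‖ < L` for `σ ∈ [0, s₂)`. [folklore] -/
theorem exists_firstExit (hYc : Continuous Y) {L S : ℝ} (h0 : ‖Y 0‖ < L)
    (hexit : ∃ s ∈ Icc 0 S, L ≤ ‖Y s‖) :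
    ∃ s₂ ∈ Ioc 0 S, ‖Y s₂‖ = L ∧ ∀ σ ∈ Ico 0 s₂, ‖Y σ‖ < L := by
  set T : Set ℝ := Icc 0 S ∩ {s | L ≤ ‖Y s‖} with hT
  have hTc : IsClosed T := isClosed_Icc.inter (isClosed_le continuous_const hYc.norm)
  obtain ⟨s, hs, hsL⟩ := hexit
  have hTne : T.Nonempty := ⟨s, hs, hsL⟩
  have hTb : BddBelow T := ⟨0, fun x hx => hx.1.1⟩
  set s₂ := sInf T with hs₂
  have hs₂T : s₂ ∈ T := hTc.csInf_mem hTne hTb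
  have hbelow : ∀ σ ∈ Ico 0 s₂, ‖Y σ‖ < L := by
    intro σ hσ
    by_contra hcon
    push Not at hcon
    have hσT : σ ∈ T := ⟨⟨hσ.1, (hσ.2.le.trans hs₂T.1.2)⟩, hcon⟩
    exact absurd (csInf_le hTb hσT) (not_le.2 hσ.2)
  have hs₂pos : 0 < s₂ := by
    rcases eq_or_lt_of_le hs₂T.1.1 with h | h
    · exfalso; have := hs₂T.2; rw [← h] at this; exact absurd h0 (not_lt.2 this)
    · exact h
  -- `‖Y s₂‖ ≤ L` by continuity from the left
  have hle : ‖Y s₂‖ ≤ L := by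
    have htend : Tendsto (fun σ => ‖Y σ‖) (𝓝[<] s₂) (𝓝 ‖Y s₂‖) :=
      (hYc.norm.tendsto s₂).mono_left nhdsWithin_le_nhds
    refine le_of_tendsto htend ?_
    filter_upwards [Ioo_mem_nhdsLT hs₂pos] with σ hσ
    exact (hbelow σ ⟨hσ.1.le, hσ.2⟩).le
  exact ⟨s₂, ⟨hs₂pos, hs₂T.1.2⟩, le_antisymm hle hs₂T.2, hbelow⟩

/-- **Per-label feeding law, first-exit form.** Along a backward orbit `Y' = −W(Y)` on the window
`[0, S]` with `‖Y 0‖ ≤ R` which reaches `‖·‖ ≥ 2R` at some time in `[0, S]`: with `G`, `N`, Lemma K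
as in `volume_toReal_le_feeding`,
`|G| ≤ 4R · √(∫_{[0,S]} 1_{stay}(s) 1_N(Y s) ds) · √(∫_{[0,S]} 1_{stay}(s) 1_N(Y s)‖V(Y s)‖² ds)`,
where `stay(s) :⟺ ∀ σ ∈ [0, s], ‖Y σ‖ ≤ 2R`.
[cite: ConstantinIgnatovaVicol2026Putative, §3.5 (first exits are fast)] -/
theorem volume_toReal_le_feeding_of_exit (hV : Continuous V) (hγ : 0 ≤ γ) (hR : 0 < R)
    (hY : ∀ s, HasDerivAt Y (-(selfSimilarTransport γ 0 V (Y s))) s)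
    {S : ℝ} (h0 : ‖Y 0‖ ≤ R) (hexit : ∃ s ∈ Icc 0 S, 2 * R ≤ ‖Y s‖)
    (hNm : MeasurableSet N) (hGm : MeasurableSet G) (hG : G ⊆ Icc (R ^ 2) ((2 * R) ^ 2))
    (hK : ∀ z, ‖z‖ ^ 2 ∈ G → ⟪V z, z⟫ + γ * ‖z‖ ^ 2 < 0 → z ∈ N) :
    (volume G).toReal ≤
      4 * R * Real.sqrt (∫ s in Icc 0 S,
          ({s : ℝ | ∀ σ ∈ Icc 0 s, ‖Y σ‖ ≤ 2 * R} ∩ Y ⁻¹' N).indicator (fun _ => (1 : ℝ)) s) *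
        Real.sqrt (∫ s in Icc 0 S,
          ({s : ℝ | ∀ σ ∈ Icc 0 s, ‖Y σ‖ ≤ 2 * R} ∩ Y ⁻¹' N).indicator (fun s => ‖V (Y s)‖ ^ 2) s) := by
  have hYc : Continuous Y := continuous_iff_continuousAt.2 fun s => (hY s).continuousAt
  obtain ⟨s₂, hs₂, hYs₂, hbelow⟩ := exists_firstExit hYc (lt_of_le_of_lt h0 (by linarith)) hexit
  have hmain := volume_toReal_le_feeding hV hγ hR hY hs₂.1.le h0 hYs₂.ge hNm hGm hG hK
  -- on `[0, s₂]` the stay indicator is `1`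
  set W : Set ℝ := {s : ℝ | ∀ σ ∈ Icc 0 s, ‖Y σ‖ ≤ 2 * R} with hW
  have hWm : MeasurableSet W := measurableSet_stayWindow (2 * R)
  have hstay : ∀ s ∈ Icc 0 s₂, s ∈ W := by
    intro s hs σ hσ
    rcases eq_or_lt_of_le (hσ.2.trans hs.2) with h | h
    · rw [h, hYs₂]
    · exact (hbelow σ ⟨hσ.1, h⟩).le
  have hYNm : MeasurableSet (Y ⁻¹' N) := hNm.preimage hYc.measurable
  -- compare the two pairs of integrals
  have hmono : ∀ (φ : ℝ → ℝ), Continuous φ → (∀ s, 0 ≤ φ s) →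
      ∫ s in Icc 0 s₂, (Y ⁻¹' N).indicator φ s ≤ ∫ s in Icc 0 S, (W ∩ Y ⁻¹' N).indicator φ s := by
    intro φ hφc hφ
    have hEq : EqOn (fun s => (Y ⁻¹' N).indicator φ s) (fun s => (W ∩ Y ⁻¹' N).indicator φ s)
        (Icc 0 s₂) := by
      intro s hs
      by_cases hN : Y s ∈ N
      · simp only [Set.indicator_of_mem (show s ∈ Y ⁻¹' N from hN),
          Set.indicator_of_mem (show s ∈ W ∩ Y ⁻¹' N from ⟨hstay s hs, hN⟩)]
      · simp only [Set.indicator_of_notMem (show s ∉ Y ⁻¹' N from hN),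
          Set.indicator_of_notMem (show s ∉ W ∩ Y ⁻¹' N from fun h => hN h.2)]
    rw [setIntegral_congr_fun measurableSet_Icc hEq]
    have hint : IntegrableOn (fun s => (W ∩ Y ⁻¹' N).indicator φ s) (Icc 0 S) volume :=
      (hφc.continuousOn.integrableOn_compact isCompact_Icc).indicator (hWm.inter hYNm)
    refine setIntegral_mono_set hint ?_ (Filter.Eventually.of_forall (Icc_subset_Icc_right hs₂.2))
    exact Filter.Eventually.of_forall fun s => Set.indicator_nonneg (fun _ _ => hφ _) _
  have hI1 := hmono (fun _ => (1 : ℝ)) continuous_const fun _ => zero_le_one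
  have hI2 := hmono (fun s => ‖V (Y s)‖ ^ 2) ((hV.comp hYc).norm.pow 2) fun _ => by positivity
  calc (volume G).toReal
      ≤ 4 * R * Real.sqrt (∫ s in Icc 0 s₂, (Y ⁻¹' N).indicator (fun _ => (1 : ℝ)) s) *
          Real.sqrt (∫ s in Icc 0 s₂, (Y ⁻¹' N).indicator (fun s => ‖V (Y s)‖ ^ 2) s) := hmain
    _ ≤ 4 * R * Real.sqrt (∫ s in Icc 0 S, (W ∩ Y ⁻¹' N).indicator (fun _ => (1 : ℝ)) s) *
          Real.sqrt (∫ s in Icc 0 S, (W ∩ Y ⁻¹' N).indicator (fun s => ‖V (Y s)‖ ^ 2) s) := by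
        gcongr

end Summit.NavierStokesRegularity.NavierStokesRegularity.Theorems.PowerGaugeEulerLiouville.NeedleFeeding
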